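import Summits.ResolutionOfSingularities.ResolutionOfSingularities.Theorems.SandwichedSingularitiesResolution
import Summits.ResolutionOfSingularities.ResolutionOfSingularities.Theorems.ValuativePatchingRelBlowupExtension
import Summits.ResolutionOfSingularities.ResolutionOfSingularities.Theorems.ValuativePatchingRelStrongBlowup
import Summits.ResolutionOfSingularities.ResolutionOfSingularities.Theorems.ValuativePatchingRelProjTwoModelPatching
import Summits.ResolutionOfSingularities.ResolutionOfSingularities.Theorems.ValuativePatchingRelQProjLine
import Summits.ResolutionOfSingularities.ResolutionOfSingularities.Theorems.RegularBlowupsDesingularization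
import Summits.ResolutionOfSingularities.ResolutionOfSingularities.Theses.Valuative
import Summits.ResolutionOfSingularities.ResolutionOfSingularities.Theses.CyclicCovers
import Literature.AlgebraicGeometry.Resolution.ProperModelsRegLeification
import Literature.AlgebraicGeometry.Resolution.CompletedPullbackRegular
import Literature.AlgebraicGeometry.Resolution.CanonicalResolutionProofs
import Literature.AlgebraicGeometry.Resolution.ProjectiveModelsModification
import Literature.AlgebraicGeometry.Resolution.ProjectiveModelsJoin
import Literature.AlgebraicGeometry.Resolution.ZariskiPatchingAllDimensions
import Literature.AlgebraicGeometry.Resolution.RegularCentreBlowupSeqExtension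
import Literature.AlgebraicGeometry.Resolution.SandwichedWeakPatching
import Literature.AlgebraicGeometry.Resolution.RegularLocusDense
import Literature.AlgebraicGeometry.Resolution.ProjectiveBirationalBlowup
import Literature.AlgebraicGeometry.Resolution.BlowupsExistence
import Literature.AlgebraicGeometry.Resolution.BlowupsLocal
import Literature.AlgebraicGeometry.Resolution.NonPrincipalLocus
import HarnessLib

/-!
# Crux `PatchingRel` (stmt-ResolutionOfSingularities-0642), line `sandwiched-gluing` (v3 cut):
# the SMALLEST-CLASS atom — blowings up of regular quasi-projective varieties, via Liu 8.1.24

Zariski patching with PROJECTIVE models (`Theorems/ValuativePatchingRelQProjLine.lean`) reduces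
the crux `Valuative.PatchingRel` to RegLe-ifying one morphism of projective models `φ : M → Y`:
find `ψ : M' → M` with `M'` regular over `Reg M` and over `Reg Y`. With Liu 2002, Thm. 8.1.24
(= Hartshorne II.7.17: a birational morphism of integral projective `k`-schemes is the blowing up
of a non-zero ideal sheaf of the target; vendored as the NAMED FACT
`Literature.AlgebraicGeometry.Resolution.Liu2002Thm8124Projective`) the sandwiched piece
`φ⁻¹(Reg Y) → Reg Y` of `φ` is LITERALLY a blowing up `Bl_I (Reg Y)` of the regular
quasi-projective variety `Reg Y` (restrict the blowing up `φ = Bl_I Y → Y` over the open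
`Reg Y ⊆ Y ⊆ ℙⁿ`, `IsBlowup.restrict`). So the smallest-class atom of the line,
`RegularBlowupSingAdmissibleResolutionQProj p` (leaf
`Theorems/RegularBlowupsDesingularization.lean`: Sing-admissible blow-up desingularization of
blowings up of regular QUASI-PROJECTIVE varieties in characteristic `p`; OPEN in dimension
`≥ 4`), already RegLe-ifies projective models:

* `projRegLeification_of_liu_of_regularBlowupSingAdmQProj` (registered stub L1
  `stub_projRegLeification_of_liu_of_regularBlowupSingAdmQProj`) — for `φ : M → Y`: Liu gives
  `φ = Bl_I Y`; the atom applied to `Bl_{I|Reg Y} (Reg Y) = φ⁻¹(Reg Y) → Reg Y` gives a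
  Sing-admissible blowing up `Bl_J φ⁻¹(Reg Y)` with regular source; it extends to the open
  `O := φ⁻¹(Reg Y) ∪ Reg M` of `M`, which is regular off `φ⁻¹(Reg Y)`
  (`exists_isBlowup_of_isBlowup_opens_of_regular_off`), and then to a blowing up of `M`
  (`exists_isPullback_of_isBlowup_opens`), projective over `k` (`IsBlowup.isProjectiveOver`),
  hence a projective model `ψ : M' → M` (`ProjModel.exists_projModel_of_isBirational`) regular
  over `O`, i.e. `ψ.RegLe ∧ (ψ.comp φ).RegLe`;
* `patchingRel_of_liu_of_regularBlowupSingAdmQProj` (registered capstone L2) — **the crux from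
  the smallest-class atom**, `Liu2002Thm8124Projective → (∀ p prime,
  RegularBlowupSingAdmissibleResolutionQProj p) → PatchingRel`, via
  `projTwoModelPatching_of_projRegLeification` and `resolutionInChar_of_twoModelPatching_of_relLU`;
  CONDITIONAL on the theorem-in-print `Liu2002Thm8124Projective` and the open conjecture only.

## References

* Q. Liu, *Algebraic Geometry and Arithmetic Curves*, OUP 2002, Thm. 8.1.24. [Liu2002]
* O. Piltant, *An axiomatic version of Zariski's patching theorem*, RACSAM 107 (2013) 91–121,
  Prop. 5.1 (proof, Steps 2 and 4) and Cor. 5.7. [Piltant2013]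
-/

-- `Summit.<Summit>.<Sub>.Theorems` with `Sub = Summit` (single-conjunct summit, D-0017): the
-- duplicated namespace component is the tree layout.
set_option linter.dupNamespace false

noncomputable section

namespace Summit.ResolutionOfSingularities.ResolutionOfSingularities.Theorems

open CategoryTheory AlgebraicGeometry TopologicalSpace
open Literature.AlgebraicGeometry.Resolution Literature.AlgebraicGeometry.Motives

universe u

/-- **Liu 8.1.24 + SingAdm_qp(p) ⇒ RegLe-ification of one morphism of PROJECTIVE models**
(Piltant 2013, proof of Prop. 5.1, Steps 2 and 4, with the resolver applied to a blowing up of a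
regular quasi-projective variety): for `φ : M → Y` a morphism of projective models of `K/k`
(`char k = p`), Liu 2002 Thm. 8.1.24 writes `φ` as the blowing up of `Y` along a non-zero ideal
sheaf `I`; over the regular quasi-projective open `Reg Y` it restricts to the blowing up
`η' : φ⁻¹(Reg Y) → Reg Y` along `I|Reg Y ≠ 0` (the generic point of `Y` is regular and not in
`V(I)`); the atom desingularises `φ⁻¹(Reg Y)` by a Sing-admissible blowing up, which extends to
the open `O := φ⁻¹(Reg Y) ∪ Reg M` (regular off `φ⁻¹(Reg Y)`) and then to a blowing up of `M`,
projective over `k`, hence a projective model `ψ : M' → M` regular over `O`: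
`ψ⁻¹(Reg M) ⊆ Reg M'` and `(φψ)⁻¹(Reg Y) ⊆ Reg M'`. [cite: Liu2002, Thm. 8.1.24]
[cite: Piltant2013, Prop. 5.1 (proof, Steps 2 and 4)] -/
theorem projRegLeification_of_liu_of_regularBlowupSingAdmQProj
    (hL : Liu2002Thm8124Projective.{u}) {p : ℕ}
    (hS : RegularBlowupSingAdmissibleResolutionQProj.{u} p) {k : Type u} [Field k] [CharP k p]
    {K : Type u} [Field K] [Algebra k K] (M Y : ProjModel k K) (φ : M.Hom Y) :
    ∃ (M' : ProjModel k K) (ψ : M'.Hom M), ψ.RegLe ∧ (ψ.comp φ).RegLe := by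
  -- Liu 8.1.24: `φ` is the blowing up of `Y` along a non-zero ideal sheaf `I`
  obtain ⟨I, hI, hφblow⟩ := hL k M.X Y.X φ.f M.π Y.π inferInstance inferInstance
    M.isProjectiveOver Y.isProjectiveOver φ.f_π φ.isBirational
  let UY : Y.X.Opens :=
    ⟨Scheme.regularLocus Y.X, isOpen_regularLocus_of_locallyOfFiniteType_field Y.π⟩
  let RM : M.X.Opens :=
    ⟨Scheme.regularLocus M.X, isOpen_regularLocus_of_locallyOfFiniteType_field M.π⟩
  let V : M.X.Opens := φ.f ⁻¹ᵁ UY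
  let O : M.X.Opens := V ⊔ RM
  have hVO : V ≤ O := le_sup_left
  have hgenY : genericPoint Y.X ∈ UY := by
    show genericPoint Y.X ∈ Scheme.regularLocus Y.X
    apply Scheme.genericPoints_subset_regularLocus
    rw [genericPoints_eq_singleton]
    rfl
  haveI : Nonempty (UY : Scheme.{u}) := ⟨⟨_, hgenY⟩⟩
  haveI : IsIntegral (UY : Scheme.{u}) := isIntegral_of_isOpenImmersion UY.ι
  have hUreg : Scheme.IsRegular (UY : Scheme.{u}) := fun u =>
    (isRegularLocalRing_stalk_iff_of_isOpenImmersion UY.ι u).mp u.2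
  have hout : ∀ x : M.X, x ∈ O → x ∉ V → IsRegularLocalRing (M.X.presheaf.stalk x) := by
    intro x hx hxV
    rcases Opens.mem_sup.mp hx with h | h
    · exact absurd h hxV
    · exact h
  -- `O` is non-empty (it contains the generic point of `M`)
  have hgenM : genericPoint M.X ∈ RM := by
    show genericPoint M.X ∈ Scheme.regularLocus M.X
    apply Scheme.genericPoints_subset_regularLocus
    rw [genericPoints_eq_singleton]
    rfl
  have hOne : (O : Set M.X).Nonempty := ⟨_, Opens.mem_sup.mpr (Or.inr hgenM)⟩
  haveI : Nonempty (O : Scheme.{u}) := hOne.to_subtype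
  haveI : IsIntegral (O : Scheme.{u}) := isIntegral_of_isOpenImmersion O.ι
  -- the sandwiched piece of `O`: `V' := O ∩ V ≅ V`, a blowing up of `Reg Y` along `I|Reg Y`
  let V' : (O : Scheme.{u}).Opens := O.ι ⁻¹ᵁ V
  let e : (V' : Scheme.{u}) ≅ (V : Scheme.{u}) := Scheme.Opens.isoOfLE hVO
  let η' : (V' : Scheme.{u}) ⟶ (UY : Scheme.{u}) := e.hom ≫ (φ.f ∣_ UY)
  have hη'blow : IsBlowup η' (I.comap UY.ι) := (hφblow.restrict UY).iso_comp e
  -- `I|Reg Y ≠ 0`: the generic point of `Y` is regular and not in `V(I)`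
  have hIne : I.comap UY.ι ≠ ⊥ := by
    intro h
    have hsupp : ((I.comap UY.ι).support : Set (UY : Scheme.{u})) = Set.univ := by
      rw [h, Scheme.IdealSheafData.support_bot]; rfl
    rw [Scheme.IdealSheafData.support_comap, Closeds.coe_preimage] at hsupp
    have hmem : (⟨genericPoint Y.X, hgenY⟩ : (UY : Scheme.{u})) ∈
        UY.ι ⁻¹' (I.support : Set Y.X) := by
      rw [hsupp]; trivial
    exact not_mem_support_genericPoint hI hmem
  have hout' : ∀ x : (O : Scheme.{u}), x ∉ V' →
      IsRegularLocalRing ((O : Scheme.{u}).presheaf.stalk x) := fun x hx =>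
    (isRegularLocalRing_stalk_iff_of_isOpenImmersion O.ι x).mp (hout x.1 x.2 hx)
  -- the atom on the blowing up `η' : V' → Reg Y` of the regular quasi-projective `Reg Y ↪ Y ↪ ℙⁿ`
  obtain ⟨J, N₁, π₁, hJ, hJsing, hπ₁, hreg₁⟩ := hS k (UY : Scheme.{u}) (V' : Scheme.{u})
    (UY.ι ≫ Y.π) η' (I.comap UY.ι) inferInstance inferInstance inferInstance inferInstance hUreg
    ⟨Y.X, Y.π, UY.ι, Y.isProjectiveOver, inferInstance, rfl⟩ hIne hη'blow
  -- extend the Sing-admissible blowing up of `V'` to `O` (regular off `V'`)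
  obtain ⟨I₀, N₀, π, hI₀, -, hπ, hreg⟩ :=
    exists_isBlowup_of_isBlowup_opens_of_regular_off (O.ι ≫ M.π) V' hout' hJ hJsing hπ₁ hreg₁
  -- extend the blowing up to `M`: a PROJECTIVE modification
  obtain ⟨Z, ρ, s, hZ, hρ, hbir, hs, hsq, hblow⟩ := exists_isPullback_of_isBlowup_opens O hI₀ hπ
  haveI := hZ
  haveI := hρ
  haveI := hs
  have hproj : IsProjectiveOver (Over.mk (ρ ≫ M.π) : SchemeOver k) :=
    hblow.isProjectiveOver M.π M.isProjectiveOver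
  have hregO : ∀ z : Z, ρ z ∈ O → IsRegularLocalRing (Z.presheaf.stalk z) := fun z hz =>
    isRegularLocalRing_stalk_of_isPullback_ι hsq (S := (O : Set M.X)) le_rfl
      (fun m _ => hreg m) z hz
  obtain ⟨M', ψ, e', hψ⟩ := M.exists_projModel_of_isBirational ρ hbir hproj
  subst e'
  rw [eqToHom_refl, Category.id_comp] at hψ
  refine ⟨M', ψ, fun y hy => ?_, fun y hy => ?_⟩
  · rw [hψ] at hy
    have := hregO y (Opens.mem_sup.mpr (Or.inr hy))
    simpa [hψ] using this
  · rw [ProjModel.Hom.comp_f, Scheme.Hom.comp_apply, hψ] at hy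
    have := hregO y (hVO (show φ.f (ρ y) ∈ UY from hy))
    simpa [hψ] using this

/-- **Registered stub L1** (universe `0`): Liu 8.1.24 + SingAdm_qp(p) ⇒ RegLe-ification of
projective models. [cite: Liu2002, Thm. 8.1.24]
[cite: Piltant2013, Prop. 5.1 (proof, Steps 2 and 4)] -/
theorem stub_projRegLeification_of_liu_of_regularBlowupSingAdmQProj :
    Literature.AlgebraicGeometry.Resolution.Liu2002Thm8124Projective.{0} → ∀ p : ℕ,
      RegularBlowupSingAdmissibleResolutionQProj.{0} p → ∀ (k : Type) [Field k] [CharP k p]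
      (K : Type) [Field K] [Algebra k K] (M Y : Literature.AlgebraicGeometry.Resolution.ProjModel k K)
      (φ : M.Hom Y), ∃ (M1 : Literature.AlgebraicGeometry.Resolution.ProjModel k K) (ψ : M1.Hom M),
        ψ.RegLe ∧ (ψ.comp φ).RegLe :=
  fun hL _ hS _ _ _ _ _ _ M Y φ =>
    projRegLeification_of_liu_of_regularBlowupSingAdmQProj hL hS M Y φ

/-- Per-prime slice: Liu 8.1.24, SingAdm_qp(p) and relative local uniformization give
`ResolutionInChar.{0} p`, with PROJECTIVE models throughout (RegLe-ification ⇒ two-model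
patching by `projTwoModelPatching_of_projRegLeification`, then the resolving system
`resolutionInChar_of_twoModelPatching_of_relLU`). [cite: Piltant2013, Prop. 5.1 and Cor. 5.7] -/
theorem resolutionInChar_of_liu_of_regularBlowupSingAdmQProj_of_lurel (p : ℕ)
    (hL : Liu2002Thm8124Projective.{0}) (hS : RegularBlowupSingAdmissibleResolutionQProj.{0} p)
    (hLU : ∀ (k K : Type) [Field k] [CharP k p] [Field K] [Algebra k K],
      (⊤ : IntermediateField k K).FG → ∀ O : ValuationSubring K,
        (∀ c : k, algebraMap k K c ∈ O) → ∀ R : Subalgebra k K, R.FG →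
          R.toSubring ≤ O.toSubring →
            ∃ (A : Subalgebra k K) (h : A.toSubring ≤ O.toSubring), R ≤ A ∧ A.FG ∧
              IsFractionRing A K ∧ IsRegularLocalRing (Localization.AtPrime
                (Ideal.comap (Subring.inclusion h) (IsLocalRing.maximalIdeal O)))) :
    ResolutionInChar.{0} p := by
  refine resolutionInChar_of_twoModelPatching_of_relLU (p := p) ?_ hLU
  intro k _ _ K _ _ _ M₁ M₂
  exact projTwoModelPatching_of_projRegLeification
    (fun M Y φ => projRegLeification_of_liu_of_regularBlowupSingAdmQProj hL hS M Y φ) M₁ M₂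

/-- **Crux `PatchingRel` from Sing-admissible blow-up desingularization of blowings up of regular
QUASI-PROJECTIVE varieties** (registered capstone `patchingRel_of_liu_of_regularBlowupSingAdmQProj`,
the smallest-class atom of the line): if, in every prime characteristic, every blowing up
`Bl_I U` of a regular quasi-projective variety `U` is desingularised by one blowing up cosupported
in its singular locus, then relative local uniformization implies resolution of singularities.
CONDITIONAL on the theorem-in-print `Liu2002Thm8124Projective` (Liu 2002, Thm. 8.1.24) and the
open conjecture `RegularBlowupSingAdmissibleResolutionQProj` only. [cite: Liu2002, Thm. 8.1.24]
[cite: Piltant2013, Prop. 5.1 and Cor. 5.7] -/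
theorem patchingRel_of_liu_of_regularBlowupSingAdmQProj :
    Literature.AlgebraicGeometry.Resolution.Liu2002Thm8124Projective.{0} →
    (∀ p : ℕ, p.Prime → RegularBlowupSingAdmissibleResolutionQProj.{0} p) →
    Summit.ResolutionOfSingularities.ResolutionOfSingularities.Theses.Valuative.PatchingRel :=
  fun hL hS p hp hLU =>
    resolutionInChar_of_liu_of_regularBlowupSingAdmQProj_of_lurel p hL (hS p hp) hLU

/-- The same for the `CyclicCovers` copy of the crux (the same term). [folklore] -/
theorem cyclicCovers_patchingRel_of_liu_of_regularBlowupSingAdmQProj :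
    Literature.AlgebraicGeometry.Resolution.Liu2002Thm8124Projective.{0} →
    (∀ p : ℕ, p.Prime → RegularBlowupSingAdmissibleResolutionQProj.{0} p) →
    Summit.ResolutionOfSingularities.ResolutionOfSingularities.Theses.CyclicCovers.PatchingRel :=
  patchingRel_of_liu_of_regularBlowupSingAdmQProj

end Summit.ResolutionOfSingularities.ResolutionOfSingularities.Theorems

end
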